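import Literature.AnabelianGeometry.EtaleTheta.Thm56SubdagProofs

/-!
# [EtTh] Thm. 5.6 (i) ⟹ the input (K4β) of the Thm. 5.7 Kummer comparison: `Ψ^Aut_β ∘ ρ_{B_N} = ρ_{B_N} ∘ γ_Δ` with
# `γ_Δ := ((l·Δ_Θ) ⊗ ℤ/Nℤ)(β) ∘ aΨ_{B_N}` — generic over a §5 datum, from `PreservesRigidityIso` + functoriality of `ρ` at `β`

Mochizuki, *The étale theta function and its Frobenioid-theoretic manifestations*, Publ. RIMS **45** (2009), Thm. 5.6 proof p. 329 (PDF
p. 103) («`Ψ` preserves … the natural isomorphism `(l·Δ_Θ)_S ⊗ ℤ/Nℤ ⥲ μ_N(S)`»), Thm. 5.7 proof p. 330 (PDF p. 104).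
[cite: MochizukiEtTh2009, Thm 5.6 p.328–329 (PDF pp.102–103); Thm 5.7 p.330 (PDF p.104)]  abc-iut cell, layer L2, K4 side of the
R408 «HC» junction of abc-iut-L2-d4's `kummerComparison_of_pin` (p449260) — seat abc-iut-w5-d034 (gen 5).  PROOF-ONLY.

`ThetaFrobenioid.Thm56Sub.psiAut_rigidity_eq_rigidity_transport` — for ANY §5 datum `𝔉`, a self-equivalence `Ψ`, `β : Ψ(B_N) ⥲ B_N`, a
rigidity family `ρ` FUNCTORIAL for linear morphisms (`IsFunctorialLinear`, Prop. 5.5) whose isomorphisms `Ψ` PRESERVES through a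
Δ-transport `aΨ` (`PreservesRigidityIso`, Thm. 5.6 (i) — exactly what the K4 end knits conclude), and abc-iut-w5-d020's
`UnitsPullSpec` (the unit pull-back along linear morphisms intertwines; THEOREM at the assembled data, `unitsPullSpec_ofBiKummerData`):

  `Ψ^Aut_β (ρ_{B_N} x) = ρ_{B_N} (((l·Δ_Θ) ⊗ ℤ/Nℤ)(β) (aΨ_{B_N} x))`   for every `x ∈ (l·Δ_Θ)_{B_N} ⊗ ℤ/Nℤ`,

i.e. the hypothesis (K4β) `hK4 : ∀ x, 𝔉.psiAut Ψ β (ρ x) = ρ (γΔ x)` of `kummerComparison_of_pin` with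
`ρ := (↑) ∘ ρ_{B_N}` and `γΔ := 𝔉.lDeltaModNMap β.hom ∘ aΨ 𝔉.BN`.  With this `γΔ`, abc-iut-w5-d020's typed T56-L09c predicate
`Thm56Sub.DeltaTransportCompat 𝔉 Ψ β aΨ θ P` (a THEOREM at the genuine level-`N` data since p447720 / p448631) reads
`γΔ [P.proj h] = [P.proj (θ h)]` verbatim — the bridge to the comparison's `η̃ := [P.proj −]`.
Proof = the tail of abc-iut-w5-d020's `transportAtBN_of` (p417981) read forwards: `Ψ^Aut_β = β.conjAut ∘ Ψ.mapAut` (`psiAut_eq_conjAut`),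
Thm. 5.6 (i) at `S := B_N`, functoriality of `ρ` at the LINEAR isomorphism `β` (`isLinear_iso_hom`), and «the unit pull-back along `β` is
`β`-conjugation» (`muTorsionPull_iso_eq`).  HONEST FRAMING: kernel-checked implication between typed statements; `PreservesRigidityIso` /
`IsFunctorialLinear` are hypotheses here (conclusions of the K4 knits elsewhere); typed ≠ discharged; no side taken on [IUTchIII] Cor. 3.12.
-/

namespace Literature.AnabelianGeometry.EtaleTheta

open CategoryTheory FrobenioidCyclotomicRigidity

universe w v v' u u'

namespace ThetaFrobenioid

namespace Thm56Sub

variable {C : Type u} [Category.{v} C] {D : Type u'} [Category.{v'} D] {𝔉 : ThetaFrobenioid.{w} C D}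

/-- **(K4β) from Thm. 5.6 (i)**: `Ψ^Aut_β (ρ_{B_N} x) = ρ_{B_N} (((l·Δ_Θ) ⊗ ℤ/Nℤ)(β) (aΨ_{B_N} x))`.
[cite: MochizukiEtTh2009, Thm 5.6 proof p.329 (PDF p.103); Thm 5.7 proof p.330 (PDF p.104)] -/
theorem psiAut_rigidity_eq_rigidity_transport (Ψ : C ≌ C) (β : Ψ.functor.obj 𝔉.BN ≅ 𝔉.BN) (hspec : UnitsPullSpec 𝔉)
    (aΨ : ∀ S : C, 𝔉.lDeltaModN S ≃* 𝔉.lDeltaModN (Ψ.functor.obj S)) (ρ : RigidityFamily 𝔉)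
    (hB : 𝔉.IsThetaSaturated 𝔉.BN) (hΨB : 𝔉.IsThetaSaturated (Ψ.functor.obj 𝔉.BN))
    (hpres : PreservesRigidityIso 𝔉 Ψ ρ aΨ) (hρ : IsFunctorialLinear 𝔉 ρ) (x : 𝔉.lDeltaModN 𝔉.BN) :
    𝔉.psiAut Ψ β (ρ 𝔉.BN hB x : Aut 𝔉.BN) = (ρ 𝔉.BN hB (𝔉.lDeltaModNMap β.hom (aΨ 𝔉.BN x)) : Aut 𝔉.BN) := by
  have h56 := hpres.2 𝔉.BN hB hΨB x
  have hfun := hρ β.hom (𝔉.isLinear_iso_hom β) hΨB hB (aΨ 𝔉.BN x)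
  rw [psiAut_eq_conjAut, h56, ← hfun, muTorsionPull_iso_eq 𝔉 hspec β 𝔉.N]

/-- The same with the theta-saturation of `Ψ(B_N)` taken from `PreservesThetaSaturated` (the first clause of abc-iut-L2-t4's
`CyclotomicRigidityPreserved`, the K4 knits' conclusion). [cite: MochizukiEtTh2009, Thm 5.6 p.328 (PDF p.102)] -/
theorem psiAut_rigidity_eq_rigidity_transport_of_preserved (Ψ : C ≌ C) (β : Ψ.functor.obj 𝔉.BN ≅ 𝔉.BN)
    (hspec : UnitsPullSpec 𝔉) (aΨ : ∀ S : C, 𝔉.lDeltaModN S ≃* 𝔉.lDeltaModN (Ψ.functor.obj S)) (ρ : RigidityFamily 𝔉)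
    (hB : 𝔉.IsThetaSaturated 𝔉.BN) (hcr : CyclotomicRigidityPreserved 𝔉 Ψ ρ aΨ) (hρ : IsFunctorialLinear 𝔉 ρ)
    (x : 𝔉.lDeltaModN 𝔉.BN) :
    𝔉.psiAut Ψ β (ρ 𝔉.BN hB x : Aut 𝔉.BN) =
      (ρ 𝔉.BN hB (𝔉.lDeltaModNMap β.hom (aΨ 𝔉.BN x)) : Aut 𝔉.BN) :=
  psiAut_rigidity_eq_rigidity_transport Ψ β hspec aΨ ρ hB ((hcr.1 𝔉.BN).1 hB) hcr.2 hρ x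

end Thm56Sub

end ThetaFrobenioid

end Literature.AnabelianGeometry.EtaleTheta
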